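import Summits.HodgeConjecture.HodgeConjecture.Theses.HeckePrymWeil
import Summits.HodgeConjecture.HodgeConjecture.Theorems.HeckePrymWeilWeilTwelvefoldsSqrtMinus7HodgeModelFacts
import Literature.AlgebraicGeometry.Motives.AbelianVarietyProductDimProofs
import Literature.AlgebraicGeometry.Motives.AbelianVarietyComplexPoints
import Literature.AlgebraicGeometry.Motives.VarietiesDimensionProofs
import Literature.AlgebraicGeometry.HodgeTheory.TorusRationalClasses
import Literature.AlgebraicGeometry.HodgeTheory.HodgeTypePullback
import Literature.AlgebraicGeometry.HodgeTheory.HodgeTypeConjugation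
import Literature.AlgebraicTopology.SingularHomology.TorusCohomologyRing
import Literature.Geometry.Kaehler.ComplexTorusAverage
import Literature.NumberTheory.EllipticCurves.ComplexTorusAnalytification
import Literature.NumberTheory.EllipticCurves.ComplexTorusAddProofs
import Literature.NumberTheory.EllipticCurves.AbelianVarietyBridgeFullProofs
import HarnessLib

/-!
# Crux `HeckePrymAnchors` (stmt-HodgeConjecture-14496), line `Sketch` · stub WS `stub_weilSurface`

Route `HeckePrymWeil`. For every `p > 0` (the stub asks `p` prime, `p ≡ 3 (4)`, `p ≥ 7`) there is a
complex abelian SURFACE `B` with `ψ ∈ End B`, `ψ ≫ ψ = -p·𝟙`, and a NON-ZERO RATIONAL class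
`b ∈ H²(B(ℂ); ℂ)` of Hodge type `(1,1)` in the typed Weil plane `Eig((𝟙+ψ)^*, (1+i√p)²) ⊔
Eig((𝟙+ψ)^*, (1-i√p)²)` — the verbatim `B`-clause of the crux. CM-free witness, uniform in `p`
(van Geemen, LNM 1594, Lemma 5.2; Deligne, LNM 900, proof of Thm. 4.8): `B = E × E` for the
elliptic curve `E = E_Λ`, `Λ = ℤ + iℤ` (`WeierstrassCurve.abelianVarietyOfAddHom`), `ψ` the companion
of `T² + p`, `(x, y) ↦ (-p·y, x)`, `b = pr₁^*ω - p·pr₂^*ω` for the top class `ω = x₀ ⌣ x₁` of `E`.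
PROVED on the tree's real carriers: the glued addition morphism of `E` is the chord–tangent law on
`ℂ`-points (`ws_pointEquiv_symm_addHom`), so the uniformisation `Θ : T² = ℂ/Λ ≃ₜ E(ℂ)`
(`PeriodPair.isHomeomorph_torusPoint`, `toPoint_add_holds`) is a group isomorphism; hence pull-back
of the coordinate classes `xᵢ ∈ H¹(E(ℂ); ℂ)` is ADDITIVE in the homomorphism (`map_add_circleClass`),
`h^*ω = h^*x₀ ⌣ h^*x₁` is a quadratic form in `h = u·pr₁ + v·pr₂`, and with `(𝟙+ψ) ≫ pr₁ = pr₁ - p·pr₂`,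
`(𝟙+ψ) ≫ pr₂ = pr₂ + pr₁` one gets `T²b - 2(1-p)·Tb + (1+p)²·b = 0`, `T = (𝟙+ψ)^*` (`ws_key`), i.e.
`(T-μ)(T-ν) b = 0`, `μ ≠ ν` the two eigenvalues, whence `b ∈ E_μ ⊔ E_ν`; `ω ≠ 0` (`torusTop_ne_zero`)
gives `b ≠ 0` (restrict to `E × 0`); `ω` is rational (`isRationalClass_torusMonomial`); every class in
`H²` of the CURVE `E` is of type `(1,1)` (a Hodge model of `E` is charted on `ℂ`: `H^{2,0} = H^{0,2} = 0`
plus the Hodge decomposition of the model) and pull-backs preserve Hodge types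
(`IsOfHodgeType.map_of_independent`). The `ws_*` declarations are the helpers of this stub
(`def`s: period pair, curve `E`, homeomorphism `Θ`, coordinates, `xᵢ`, `ω`, `ψ`, `b`, `ws_Λ`).
-/

noncomputable section
-- every declaration of this problem lives in Summit.HodgeConjecture.HodgeConjecture.… (summit = sub-problem)
set_option linter.dupNamespace false

open CategoryTheory AlgebraicGeometry MonoidalCategory CartesianMonoidalCategory
open Literature.AlgebraicGeometry Literature.AlgebraicGeometry.Motives Literature.AlgebraicGeometry.HodgeTheory
open Literature.AlgebraicTopology.SingularHomology Literature.Geometry.Kaehler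

namespace Summit.HodgeConjecture.HodgeConjecture.Theorems.HeckePrymWeilLine

open scoped MonObj

/-- The period pair `(1, i)` of the lattice `Λ = ℤ + iℤ`. [cite: SilvermanAEC2009, VI §3] -/
def ws_L : PeriodPair :=
  ⟨1, Complex.I, by rw [← Complex.coe_basisOneI]; exact Complex.basisOneI.linearIndependent⟩

/-- The Weierstrass cubic `E_Λ : y² = x³ - (g₂/4)x - g₃/4` of `Λ`. [cite: SilvermanAEC2009, Prop. VI.3.6] -/
abbrev ws_W : WeierstrassCurve ℂ := ws_L.curve

/-- **The elliptic curve `E_Λ` as an abelian variety over `ℂ`** (Silverman III.3.6). [cite: SilvermanAEC2009, III.3.6] -/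
def ws_E : AbelianVariety ℂ :=
  ws_W.abelianVarietyOfAddHom ws_W.addHom ws_W.negHom ws_W.lift_pointEquiv_comp_addHom
    ws_W.pointEquiv_comp_negHom_geom

/-- `E` is a smooth projective curve. [cite: SilvermanAEC2009, III.3.1(c)] -/
theorem ws_isSmoothProjective_E : IsSmoothProjective 1 ws_E.X := ws_W.isSmoothProjective_scheme

/-- `dim E = 1`. [cite: SilvermanAEC2009, III.3.1(c)] -/
theorem ws_dim_E : ws_E.dim = 1 := schemeDim_eq_holds ws_isSmoothProjective_E

/-- **The glued addition morphism is the chord–tangent law on `ℂ`-points** (the `ℂ`-point analogue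
of `AddAtlas.toGeomPoint_addHom`: a point lies in some law chart, and both Bosma–Lenstra laws compute
the sum on field-valued points). [cite: SilvermanAEC2009, III.3.6] [cite: BosmaLenstra1995, Theorem 2] -/
theorem ws_pointEquiv_symm_addHom (p : AlgPoints (ws_W.scheme ⊗ ws_W.scheme) ℂ) :
    ws_W.pointEquiv.symm (p ≫ ws_W.addHom) =
      ws_W.pointEquiv.symm (p ≫ fst ws_W.scheme ws_W.scheme) +
        ws_W.pointEquiv.symm (p ≫ snd ws_W.scheme ws_W.scheme) := by
  set pl : Spec (CommRingCat.of ℂ) ⟶ (ws_W.scheme ⊗ ws_W.scheme).left := p.left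
  obtain ⟨⟨c, d, i, e⟩, y, hy⟩ := ws_W.addAtlas.covers (pl (IsLocalRing.closedPoint ℂ))
  have hrange : Set.range pl ⊆ Set.range (ws_W.lawChart c d i e).ι := by
    rintro _ ⟨s, hs⟩
    rw [← hs, Subsingleton.elim s (IsLocalRing.closedPoint ℂ)]
    exact ⟨y, hy⟩
  set ℓ : Spec (CommRingCat.of ℂ) ⟶ Spec (CommRingCat.of (ws_W.LawSrc c d i e)) :=
    IsOpenImmersion.lift (H := (ws_W.lawChart c d i e).isOpenImmersion) (ws_W.lawChart c d i e).ι pl hrange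
  have hℓ : ℓ ≫ (ws_W.lawι c d i e).left = pl :=
    IsOpenImmersion.lift_fac (H := (ws_W.lawChart c d i e).isOpenImmersion) (ws_W.lawChart c d i e).ι pl hrange
  have hpo : pl ≫ (ws_W.scheme ⊗ ws_W.scheme).hom = Spec.map (CommRingCat.ofHom (algebraMap ℂ ℂ)) :=
    Over.w p
  obtain ⟨β, hβ⟩ : ∃ β : ws_W.LawSrc c d i e →ₐ[ℂ] ℂ, ℓ = Spec.map (CommRingCat.ofHom β.toRingHom) :=
    WeierstrassCurve.exists_eq_specMap (K := ℂ) ℓ (by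
      rw [show Spec.map (CommRingCat.ofHom (algebraMap ℂ (ws_W.LawSrc c d i e))) =
          (ws_W.lawChart c d i e).ι ≫ (ws_W.scheme ⊗ ws_W.scheme).hom from (ws_W.lawChart c d i e).ι_over.symm]
      exact (Category.assoc _ _ _).symm.trans ((congrArg (· ≫ (ws_W.scheme ⊗ ws_W.scheme).hom) hℓ).trans hpo))
  have hp : p = specOverOfAlgHom β ≫ ws_W.lawι c d i e := by
    refine Over.OverMorphism.ext ?_
    rw [Over.comp_left, specOverOfAlgHom_left, ← hβ]
    exact hℓ.symm
  have hval : p ≫ ws_W.addHom = specOverOfAlgHom β ≫ ws_W.lawμ c d i e := by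
    refine Over.OverMorphism.ext ?_
    rw [Over.comp_left, Over.comp_left, specOverOfAlgHom_left, ← hβ]
    change pl ≫ ws_W.addAtlas.addHom.left = ℓ ≫ (ws_W.addAtlas.chart (c, d, i, e)).μ
    rw [← hℓ, Category.assoc]
    exact congrArg (ℓ ≫ ·) (ws_W.addAtlas.ι_comp_addHom_left (c, d, i, e))
  rw [hval, hp, Category.assoc, Category.assoc, ws_W.specOverOfAlgHom_comp_lawμ,
    ws_W.specOverOfAlgHom_comp_lawι_fst, ws_W.specOverOfAlgHom_comp_lawι_snd]
  fin_cases i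
  · exact ws_W.pointEquiv_symm_schemePoint_addXYZ _ _ _ _ _ _
  · exact ws_W.pointEquiv_symm_schemePoint_add₂XYZ _ _ _ _ _ _

/-- `[P + Q] = [P] · [Q]` in the group `E(ℂ)` of the group scheme `E`. [cite: SilvermanAEC2009, III.3.6] -/
theorem ws_pointEquiv_add (a b : ws_W.toAffine.Point) :
    ws_W.pointEquiv (a + b) = lift (ws_W.pointEquiv a) (ws_W.pointEquiv b) ≫ ws_W.addHom := by
  apply ws_W.pointEquiv.symm.injective
  rw [Equiv.symm_apply_apply, ws_pointEquiv_symm_addHom, lift_fst, lift_snd, Equiv.symm_apply_apply,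
    Equiv.symm_apply_apply]
  rfl

/-- `φ : ℂ/Λ → E(ℂ)` is a homomorphism (`toPoint_add_holds`). [cite: SilvermanAEC2009, Prop. VI.3.6 (b)] -/
theorem ws_torusPoint_add (s t : ws_L.torus) :
    ws_L.torusPoint (s + t) = lift (ws_L.torusPoint s) (ws_L.torusPoint t) ≫ ws_W.addHom := by
  obtain ⟨z, rfl⟩ := ComplexTorus.cover_surjective ws_L.periodIso s
  obtain ⟨w, rfl⟩ := ComplexTorus.cover_surjective ws_L.periodIso t
  rw [← ComplexTorus.cover_add, PeriodPair.torusPoint_cover, PeriodPair.torusPoint_cover,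
    PeriodPair.torusPoint_cover]
  change ws_W.pointEquiv (ws_L.toPoint (z + w)) = _
  rw [ws_L.toPoint_add_holds z w]
  exact ws_pointEquiv_add _ _

/-- **The uniformisation `Θ : T² = ℂ/Λ ≃ₜ E(ℂ)`.** [cite: SilvermanAEC2009, Prop. VI.3.6 (b)] -/
def ws_Θ : Torus 2 ≃ₜ ComplexPoints ws_E.X :=
  IsHomeomorph.homeomorph (fun t : Torus 2 => (ws_L.torusPoint t : ComplexPoints ws_E.X))
    ws_L.isHomeomorph_torusPoint

/-- `Θ⁻¹` is a homomorphism `E(ℂ) → T²`. [cite: SilvermanAEC2009, Prop. VI.3.6 (b)] -/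
theorem ws_Θ_symm_mul (P Q : ComplexPoints ws_E.X) : ws_Θ.symm (P * Q) = ws_Θ.symm P + ws_Θ.symm Q := by
  apply ws_Θ.injective
  rw [Homeomorph.apply_symm_apply, show ws_Θ (ws_Θ.symm P + ws_Θ.symm Q) = ws_Θ (ws_Θ.symm P) *
    ws_Θ (ws_Θ.symm Q) from ws_torusPoint_add _ _, Homeomorph.apply_symm_apply, Homeomorph.apply_symm_apply]

/-- The `i`-th circle coordinate `E(ℂ) → T² → ℝ/ℤ`. [cite: HatcherAT2002, §3.2 Example 3.16] -/
def ws_coord (i : Fin 2) : C(ComplexPoints ws_E.X, UnitAddCircle) :=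
  (torusProj 2 i).comp (ws_Θ.symm : C(ComplexPoints ws_E.X, Torus 2))

/-- The coordinate classes `xᵢ = (Θ⁻¹)^* ξᵢ ∈ H¹(E(ℂ); ℂ)`. [cite: HatcherAT2002, §3.2 Example 3.16] -/
def ws_x (i : Fin 2) : complexBetti ws_E.X 1 := singularCohomology.map ℂ ℂ (ws_coord i) 1 (circleClass ℂ)

/-- `xᵢ = (Θ⁻¹)^* ξᵢ`. [cite: HatcherAT2002, §3.2 Example 3.16] -/
theorem ws_x_eq (i : Fin 2) :
    ws_x i = singularCohomology.map ℂ ℂ (ws_Θ.symm : C(ComplexPoints ws_E.X, Torus 2)) 1 (torusXi ℂ 2 i) := by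
  rw [torusXi, singularCohomology.map_map]; rfl

/-- **Additivity on `H¹`**: `(F·G)^* xᵢ = F^* xᵢ + G^* xᵢ` for maps into `E(ℂ)`. [cite: HatcherAT2002, §3.C Exercise 11] -/
theorem ws_map_mul_x {Z : Type} [TopologicalSpace Z] (F G : C(Z, ComplexPoints ws_E.X)) (i : Fin 2) :
    singularCohomology.map ℂ ℂ (F * G) 1 (ws_x i) =
      singularCohomology.map ℂ ℂ F 1 (ws_x i) + singularCohomology.map ℂ ℂ G 1 (ws_x i) := by
  rw [ws_x, singularCohomology.map_map, singularCohomology.map_map, singularCohomology.map_map]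
  have h : (ws_coord i).comp (F * G) = (ws_coord i).comp F + (ws_coord i).comp G := by
    ext z
    change ws_Θ.symm (F z * G z) i = ws_Θ.symm (F z) i + ws_Θ.symm (G z) i
    rw [ws_Θ_symm_mul]; rfl
  rw [h, map_add_circleClass]

/-- **`f ↦ f^* xᵢ` is additive on `Hom(T, E)`** (`(f+g)(ℂ) = f(ℂ)·g(ℂ)`). [cite: MumfordAV1970, §4] -/
def ws_Λ (T : AbelianVariety ℂ) (i : Fin 2) : (T ⟶ ws_E) →+ complexBetti T.X 1 :=
  AddMonoidHom.mk' (fun f => complexBetti.map f.hom.hom.hom 1 (ws_x i)) (fun f g => by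
    have h : AlgPoints.mapContinuous (L := ℂ) (f + g).hom.hom.hom =
        AlgPoints.mapContinuous (L := ℂ) f.hom.hom.hom * AlgPoints.mapContinuous (L := ℂ) g.hom.hom.hom :=
      ContinuousMap.ext fun P => by
        change P ≫ (f.hom.hom.hom * g.hom.hom.hom) = (P ≫ f.hom.hom.hom) * (P ≫ g.hom.hom.hom)
        exact MonObj.comp_mul _ _ _
    change singularCohomology.map ℂ ℂ (AlgPoints.mapContinuous (L := ℂ) (f + g).hom.hom.hom) 1 (ws_x i) = _
    rw [h, ws_map_mul_x])

/-- **The top class `ω = x₀ ⌣ x₁ ∈ H²(E(ℂ); ℂ)`.** [cite: HatcherAT2002, §3.2 Example 3.16] -/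
def ws_ω : complexBetti ws_E.X (1 + 1) := cupProduct (rfl : 1 + 1 = 1 + 1) (ws_x 0) (ws_x 1)

/-- `ω = (Θ⁻¹)^* (ξ₀ ⌣ ξ₁)`. [cite: HatcherAT2002, §3.2 Example 3.16] -/
theorem ws_ω_eq : ws_ω = singularCohomology.map ℂ ℂ (ws_Θ.symm : C(ComplexPoints ws_E.X, Torus 2)) (1 + 1)
    (torusTop ℂ 2) := by
  have h2 : torusTop ℂ 2 = cupProduct (rfl : 1 + 1 = 1 + 1) (torusXi ℂ 2 0) (torusXi ℂ 2 1) := by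
    change cupProduct _ (cupProduct _ (singularCohomology.one ℂ (Torus 2)) (torusXi ℂ 2 0)) (torusXi ℂ 2 1) = _
    have h : cupProduct (rfl : 0 + 1 = 0 + 1) (singularCohomology.one ℂ (Torus 2)) (torusXi ℂ 2 0) =
        torusXi ℂ 2 0 := one_cupProduct _
    rw [h]
  rw [h2, cupProduct_map, ← ws_x_eq, ← ws_x_eq]; rfl

/-- `ω ≠ 0` (`ξ₀ ⌣ ξ₁ ≠ 0` on `T²`). [cite: HatcherAT2002, §3.2 Example 3.16] -/
theorem ws_ω_ne_zero : ws_ω ≠ 0 := by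
  intro h
  have h2 := congrArg (singularCohomology.map ℂ ℂ (ws_Θ : C(Torus 2, ComplexPoints ws_E.X)) (1 + 1)) h
  rw [ws_ω_eq, singularCohomology.map_map, map_zero] at h2
  have hid : (ws_Θ.symm : C(ComplexPoints ws_E.X, Torus 2)).comp (ws_Θ : C(Torus 2, ComplexPoints ws_E.X)) =
      ContinuousMap.id _ := by
    ext1 t; exact ws_Θ.symm_apply_apply t
  rw [hid, singularCohomology.map_id] at h2
  exact torusTop_ne_zero (R := ℂ) 2 h2

/-- `ω` is a rational class. [cite: HatcherAT2002, §3.1 p. 198] -/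
theorem ws_ω_rational : IsRationalClass ws_ω := by
  rw [ws_ω_eq]; exact (isRationalClass_torusMonomial _).map _

/-- `f^* ω = f^* x₀ ⌣ f^* x₁` (naturality of `⌣`). [cite: HatcherAT2002, Prop. 3.10] -/
theorem ws_map_ω {T : AbelianVariety ℂ} (f : T ⟶ ws_E) :
    complexBetti.map f.hom.hom.hom (1 + 1) ws_ω = cupProduct (rfl : 1 + 1 = 1 + 1) (ws_Λ T 0 f) (ws_Λ T 1 f) :=
  cupProduct_map _ _ _ _

open Literature.NumberTheory.Transcendental in
/-- **Every class in `H²` of the curve `E` is of type `(1,1)`** (a Hodge model of `E` is charted on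
`ℂ`, so `H^{2,0} = H^{0,2} = 0`, and `H² = ⊕ H^{p,q}`). [cite: VoisinHodgeI2002, §2.3.1 and §6.1.3] -/
theorem ws_isOfHodgeType_E (c : complexBetti ws_E.X (1 + 1)) : IsOfHodgeType 1 ws_E.X (1 + 1) 1 1 c := by
  obtain ⟨A⟩ := WeilTwelvefoldsSqrtMinus7.AmnesicSecantSheaves.nonempty_hodgeModel_all_holds 1 ws_E.X
    ws_isSmoothProjective_E
  refine ⟨A, ?_⟩
  have hfin : Module.finrank ℂ A.model = 1 := A.isAnalytification.finrank_eq
  have h20 : hodgePQ A.model A.carrier (1 + 1) 2 0 = ⊥ := hodgePQ_eq_bot_of_finrank_lt_left _ (by omega)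
  have h02 : hodgePQ A.model A.carrier (1 + 1) 0 2 = ⊥ := hodgePQ_eq_bot_of_finrank_lt_right _ (by omega)
  have htop : hodgePQ A.model A.carrier (1 + 1) 1 1 = ⊤ := by
    rw [eq_top_iff, ← (A.isInternal_hodgePQ (1 + 1)).submodule_iSup_eq_top]
    refine iSup_le fun pq => ?_
    obtain ⟨⟨a, b⟩, hab⟩ := pq
    have hab' : a + b = 1 + 1 := Finset.HasAntidiagonal.mem_antidiagonal.mp hab
    have ha : a ≤ 2 := by omega
    interval_cases a
    · obtain rfl : b = 2 := (by omega); exact h02.le.trans bot_le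
    · obtain rfl : b = 1 := (by omega); exact le_rfl
    · obtain rfl : b = 0 := (by omega); exact h20.le.trans bot_le
  change A.pullback (1 + 1) c ∈ (hodgePQ A.model A.carrier (1 + 1) 1 1).map _
  rw [htop, Submodule.map_top, LinearEquiv.range]; trivial

/-- **The abelian surface `B = E × E`.** [cite: vanGeemen1994HodgeAV, Lemma 5.2] -/
abbrev ws_B : AbelianVariety ℂ := ws_E.prod ws_E

/-- `dim B = 2`. [cite: vanGeemen1994HodgeAV, Lemma 5.2] -/
theorem ws_dim_B : ws_B.dim = 2 := by rw [AbelianVariety.dim_prod, ws_dim_E]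

/-- `B` is a smooth projective surface. [cite: MumfordAV1970, §4 (ii)] -/
theorem ws_isSmoothProjective_B : IsSmoothProjective 2 ws_B.X := by
  have h := (AbelianVariety.isSmoothProjective_holds (A := ws_B))
  rwa [AbelianVariety.isSmoothProjective, ws_dim_B] at h

/-- **The companion of `T² + p`**, `(x, y) ↦ (-p·y, x)`. [cite: Deligne1982HodgeCycles, proof of Thm. 4.8] -/
def ws_ψ (p : ℕ) : ws_B ⟶ ws_B :=
  AbelianVariety.prodLift (AbelianVariety.snd ws_E ws_E ≫ (-((p : ℤ) • 𝟙 ws_E))) (AbelianVariety.fst ws_E ws_E)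

/-- `ψ ≫ ψ = -p`. [cite: Deligne1982HodgeCycles, proof of Thm. 4.8] -/
theorem ws_ψ_comp_ψ (p : ℕ) : ws_ψ p ≫ ws_ψ p = -((p : ℤ) • 𝟙 ws_B) := by
  apply AbelianVariety.prod_hom_ext
  · rw [Category.assoc, ws_ψ, AbelianVariety.prodLift_fst, ← Category.assoc, AbelianVariety.prodLift_snd,
      Preadditive.comp_neg, Preadditive.comp_zsmul, Category.comp_id, Preadditive.neg_comp,
      Preadditive.zsmul_comp, Category.id_comp]
  · rw [Category.assoc, ws_ψ, AbelianVariety.prodLift_snd, AbelianVariety.prodLift_fst, Preadditive.comp_neg,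
      Preadditive.comp_zsmul, Category.comp_id, Preadditive.neg_comp, Preadditive.zsmul_comp, Category.id_comp]

/-- `(𝟙 + ψ) ≫ pr₁ = pr₁ - p·pr₂`. [cite: Deligne1982HodgeCycles, proof of Thm. 4.8] -/
theorem ws_g_fst (p : ℕ) : (𝟙 ws_B + ws_ψ p) ≫ AbelianVariety.fst ws_E ws_E =
    AbelianVariety.fst ws_E ws_E - (p : ℤ) • AbelianVariety.snd ws_E ws_E := by
  rw [Preadditive.add_comp, Category.id_comp, ws_ψ, AbelianVariety.prodLift_fst, Preadditive.comp_neg,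
    Preadditive.comp_zsmul, Category.comp_id, sub_eq_add_neg]

/-- `(𝟙 + ψ) ≫ pr₂ = pr₂ + pr₁`. [cite: Deligne1982HodgeCycles, proof of Thm. 4.8] -/
theorem ws_g_snd (p : ℕ) : (𝟙 ws_B + ws_ψ p) ≫ AbelianVariety.snd ws_E ws_E =
    AbelianVariety.snd ws_E ws_E + AbelianVariety.fst ws_E ws_E := by
  rw [Preadditive.add_comp, Category.id_comp, ws_ψ, AbelianVariety.prodLift_snd]

/-- `g^*(f^* c) = (g ≫ f)^* c`. [cite: HatcherAT2002, §3.1 p. 201] -/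
theorem ws_map_map {S T : AbelianVariety ℂ} (g : S ⟶ T) (f : T ⟶ ws_E) (k : ℕ) (c : complexBetti ws_E.X k) :
    complexBetti.map g.hom.hom.hom k (complexBetti.map f.hom.hom.hom k c) =
      complexBetti.map (g ≫ f).hom.hom.hom k c := by
  rw [← CategoryTheory.comp_apply, ← complexBetti.map_comp]; rfl

/-- **The Weil class `b = pr₁^* ω - p · pr₂^* ω`.** [cite: vanGeemen1994HodgeAV, Lemma 5.2] -/
def ws_b (p : ℕ) : complexBetti ws_B.X (1 + 1) :=
  complexBetti.map (AbelianVariety.fst ws_E ws_E).hom.hom.hom (1 + 1) ws_ω -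
    (p : ℂ) • complexBetti.map (AbelianVariety.snd ws_E ws_E).hom.hom.hom (1 + 1) ws_ω

/-- `b` is rational. [cite: HatcherAT2002, §3.1 p. 198] -/
theorem ws_b_rational (p : ℕ) : IsRationalClass (ws_b p) := by
  have h : ws_b p = complexBetti.map (AbelianVariety.fst ws_E ws_E).hom.hom.hom (1 + 1) ws_ω +
      ((-(p : ℚ) : ℚ) : ℂ) • complexBetti.map (AbelianVariety.snd ws_E ws_E).hom.hom.hom (1 + 1) ws_ω := by
    rw [ws_b, sub_eq_add_neg, ← neg_smul, Rat.cast_neg, Rat.cast_natCast]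
  rw [h]
  exact (ws_ω_rational.map _).add ((ws_ω_rational.map _).smul _)

/-- `b` is of Hodge type `(1,1)` (pull-backs preserve Hodge types). [cite: VoisinHodgeI2002, §7.3.2] -/
theorem ws_b_hodge (p : ℕ) : IsOfHodgeType 2 ws_B.X (1 + 1) 1 1 (ws_b p) := by
  obtain ⟨M⟩ := WeilTwelvefoldsSqrtMinus7.AmnesicSecantSheaves.nonempty_hodgeModel_all_holds 2 ws_B.X
    ws_isSmoothProjective_B
  have h := fun f : ws_B ⟶ ws_E => (ws_isOfHodgeType_E ws_ω).map_of_independent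
    hodgePQ_independent_of_hodgeModel_holds ws_isSmoothProjective_B ws_isSmoothProjective_E M f.hom.hom.hom
  exact (h _).sub ws_isSmoothProjective_B ((h _).smul _)

/-- `b ≠ 0`: its restriction to `E × 0` is `ω`. [cite: vanGeemen1994HodgeAV, Lemma 5.2] -/
theorem ws_b_ne_zero (p : ℕ) : ws_b p ≠ 0 := by
  intro h
  have h2 := congrArg (complexBetti.map (AbelianVariety.prodLift (𝟙 ws_E) 0 : ws_E ⟶ ws_B).hom.hom.hom (1 + 1)) h
  rw [map_zero, ws_b, map_sub, map_smul, ws_map_map, ws_map_map, AbelianVariety.prodLift_fst,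
    AbelianVariety.prodLift_snd, ws_map_ω (0 : ws_E ⟶ ws_E), map_zero, map_zero, LinearMap.zero_apply, smul_zero,
    sub_zero] at h2
  have h3 : complexBetti.map (𝟙 ws_E : ws_E ⟶ ws_E).hom.hom.hom (1 + 1) ws_ω = ws_ω := by
    change complexBetti.map (𝟙 ws_E.X) (1 + 1) ws_ω = ws_ω; rw [complexBetti.map_id]; rfl
  exact ws_ω_ne_zero (h3 ▸ h2)

/-- `T (f^* ω) = ((𝟙+ψ) ≫ f)^* x₀ ⌣ ((𝟙+ψ) ≫ f)^* x₁` for `T = (𝟙 + ψ)^*`. [cite: HatcherAT2002, Prop. 3.10] -/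
theorem ws_T_map_ω (p : ℕ) (f : ws_B ⟶ ws_E) :
    complexBetti.map (𝟙 ws_B + ws_ψ p).hom.hom.hom (1 + 1) (complexBetti.map f.hom.hom.hom (1 + 1) ws_ω) =
      cupProduct (rfl : 1 + 1 = 1 + 1) (ws_Λ ws_B 0 ((𝟙 ws_B + ws_ψ p) ≫ f))
        (ws_Λ ws_B 1 ((𝟙 ws_B + ws_ψ p) ≫ f)) := by
  rw [ws_map_map, ws_map_ω]

/-- **The key identity `T²b - 2(1-p)·Tb + (1+p)²·b = 0`** for `T = (𝟙 + ψ)^*` (`h^*ω` is a quadratic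
form in `h = u·pr₁ + v·pr₂`: additivity on `H¹`, bilinearity of `⌣`). [cite: vanGeemen1994HodgeAV, Lemma 5.2] -/
theorem ws_key (p : ℕ) :
    complexBetti.map (𝟙 ws_B + ws_ψ p).hom.hom.hom (1 + 1)
        (complexBetti.map (𝟙 ws_B + ws_ψ p).hom.hom.hom (1 + 1) (ws_b p)) -
      (2 * (1 - (p : ℂ))) • complexBetti.map (𝟙 ws_B + ws_ψ p).hom.hom.hom (1 + 1) (ws_b p) +
      ((1 + (p : ℂ)) ^ 2) • ws_b p = 0 := by
  have e1 : (𝟙 ws_B + ws_ψ p) ≫ ((𝟙 ws_B + ws_ψ p) ≫ AbelianVariety.fst ws_E ws_E) =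
      (AbelianVariety.fst ws_E ws_E - (p : ℤ) • AbelianVariety.snd ws_E ws_E) -
        (p : ℤ) • (AbelianVariety.snd ws_E ws_E + AbelianVariety.fst ws_E ws_E) := by
    rw [ws_g_fst, Preadditive.comp_sub, Preadditive.comp_zsmul, ws_g_fst, ws_g_snd]
  have e2 : (𝟙 ws_B + ws_ψ p) ≫ ((𝟙 ws_B + ws_ψ p) ≫ AbelianVariety.snd ws_E ws_E) =
      (AbelianVariety.snd ws_E ws_E + AbelianVariety.fst ws_E ws_E) +
        (AbelianVariety.fst ws_E ws_E - (p : ℤ) • AbelianVariety.snd ws_E ws_E) := by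
    rw [ws_g_snd, Preadditive.comp_add, ws_g_fst, ws_g_snd]
  rw [ws_b, map_sub, map_smul, map_sub, map_smul,
    ws_map_map (𝟙 ws_B + ws_ψ p) (AbelianVariety.fst ws_E ws_E),
    ws_map_map (𝟙 ws_B + ws_ψ p) ((𝟙 ws_B + ws_ψ p) ≫ AbelianVariety.fst ws_E ws_E),
    ws_map_map (𝟙 ws_B + ws_ψ p) (AbelianVariety.snd ws_E ws_E),
    ws_map_map (𝟙 ws_B + ws_ψ p) ((𝟙 ws_B + ws_ψ p) ≫ AbelianVariety.snd ws_E ws_E),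
    e1, e2, ws_g_fst, ws_g_snd]
  repeat rw [ws_map_ω]
  simp only [map_sub, map_add, map_zsmul, ← Int.cast_smul_eq_zsmul ℂ, Int.cast_natCast, LinearMap.sub_apply,
    LinearMap.add_apply]
  simp only [map_add, map_smul, LinearMap.add_apply, LinearMap.smul_apply]
  module

/-- Linear algebra: `(T - m)(T - n) b = 0`, `m ≠ n`, puts `b` in `E_m ⊔ E_n`. [folklore] -/
theorem ws_mem_sup_eigenspace {M : Type*} [AddCommGroup M] [Module ℂ M] (T : Module.End ℂ M) {m n : ℂ}
    (hmn : m ≠ n) {b : M} (h : T (T b) - (m + n) • T b + (m * n) • b = 0) :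
    b ∈ T.eigenspace m ⊔ T.eigenspace n := by
  have hd : m - n ≠ 0 := sub_ne_zero.mpr hmn
  have hT : T (T b) = (m + n) • T b - (m * n) • b := by rw [← sub_eq_zero, ← h]; module
  refine Submodule.mem_sup.mpr ⟨(m - n)⁻¹ • (T b - n • b), ?_, (m - n)⁻¹ • (m • b - T b), ?_, ?_⟩
  · rw [Module.End.mem_eigenspace_iff, map_smul, map_sub, map_smul, hT]; module
  · rw [Module.End.mem_eigenspace_iff, map_smul, map_sub, map_smul, hT]; module
  · rw [← smul_add, show T b - n • b + (m • b - T b) = (m - n) • b by module, smul_smul,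
      inv_mul_cancel₀ hd, one_smul]

/-- `(√p)² = p` in `ℂ`. [folklore] -/
theorem ws_sqrt_sq (p : ℕ) : ((Real.sqrt (p : ℝ) : ℝ) : ℂ) ^ 2 = (p : ℂ) := by
  rw [← Complex.ofReal_pow, Real.sq_sqrt (Nat.cast_nonneg _), Complex.ofReal_natCast]

/-- The two Weil eigenvalues `(1 ± i√p)²` differ (`p > 0`). [cite: vanGeemen1994HodgeAV, Lemma 5.2] -/
theorem ws_eigen_ne {p : ℕ} (hp : 0 < p) :
    (1 + Complex.I * (Real.sqrt (p : ℝ) : ℂ)) ^ (2 * 1) ≠ (1 - Complex.I * (Real.sqrt (p : ℝ) : ℂ)) ^ (2 * 1) := by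
  intro h
  have hs : ((Real.sqrt (p : ℝ) : ℝ) : ℂ) ≠ 0 := by
    exact_mod_cast (Real.sqrt_pos.mpr (by exact_mod_cast hp)).ne'
  have h4 : (4 : ℂ) * Complex.I * (Real.sqrt (p : ℝ) : ℂ) = 0 := by linear_combination h
  rcases mul_eq_zero.mp h4 with h4 | h4
  · exact mul_ne_zero (by norm_num) Complex.I_ne_zero h4
  · exact hs h4

/-- `(1 + i√p)² + (1 - i√p)² = 2(1 - p)`. [folklore] -/
theorem ws_eigen_add (p : ℕ) :
    (1 + Complex.I * (Real.sqrt (p : ℝ) : ℂ)) ^ (2 * 1) + (1 - Complex.I * (Real.sqrt (p : ℝ) : ℂ)) ^ (2 * 1) =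
      2 * (1 - (p : ℂ)) := by
  linear_combination 2 * Complex.I ^ 2 * ws_sqrt_sq p + 2 * (p : ℂ) * Complex.I_sq

/-- `(1 + i√p)² (1 - i√p)² = (1 + p)²`. [folklore] -/
theorem ws_eigen_mul (p : ℕ) :
    (1 + Complex.I * (Real.sqrt (p : ℝ) : ℂ)) ^ (2 * 1) * (1 - Complex.I * (Real.sqrt (p : ℝ) : ℂ)) ^ (2 * 1) =
      (1 + (p : ℂ)) ^ 2 := by
  linear_combination (-(2 : ℂ) * Complex.I ^ 2 + Complex.I ^ 4 * (((Real.sqrt (p : ℝ) : ℝ) : ℂ) ^ 2 + (p : ℂ))) *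
    ws_sqrt_sq p + (-(2 : ℂ) * (p : ℂ) + (p : ℂ) ^ 2 * (Complex.I ^ 2 - 1)) * Complex.I_sq

/-- **Stub WS — a Weil surface for `ℚ(√-p)` exists** (verbatim `B`-clause of the crux
`HeckePrymAnchors`): `B = E × E`, `E = ℂ/(ℤ + iℤ)`, `ψ` the companion of `T² + p`,
`b = pr₁^*ω - p·pr₂^*ω` — non-zero, rational, of type `(1,1)`, and killed by
`(T - (1+i√p)²)(T - (1-i√p)²)` for `T = (𝟙 + ψ)^*`, hence in the typed Weil plane (van Geemen,
LNM 1594, Lemma 5.2; Deligne, LNM 900, proof of Thm. 4.8). [cite: vanGeemen1994HodgeAV, Lemma 5.2] -/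
theorem stub_weilSurface :
    ∀ p : ℕ, p.Prime → p % 4 = 3 → 7 ≤ p → ∃ (B : AbelianVariety ℂ) (ψ : B ⟶ B),
      B.dim = 2 ∧ ψ ≫ ψ = -((p : ℤ) • 𝟙 B) ∧
        ∃ b : complexBetti B.X (2 * 1), b ≠ 0 ∧ IsRationalClass b ∧
          IsOfHodgeType (2 * 1) B.X (2 * 1) 1 1 b ∧
          b ∈ Module.End.eigenspace (complexBetti.map (𝟙 B + ψ).hom.hom.hom (2 * 1)).hom
                ((1 + Complex.I * (Real.sqrt (p : ℝ) : ℂ)) ^ (2 * 1)) ⊔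
              Module.End.eigenspace (complexBetti.map (𝟙 B + ψ).hom.hom.hom (2 * 1)).hom
                ((1 - Complex.I * (Real.sqrt (p : ℝ) : ℂ)) ^ (2 * 1)) := by
  intro p _ _ hp7
  refine ⟨ws_B, ws_ψ p, ws_dim_B, ws_ψ_comp_ψ p, ws_b p, ws_b_ne_zero p, ws_b_rational p, ws_b_hodge p, ?_⟩
  refine ws_mem_sup_eigenspace _ (ws_eigen_ne (by omega)) ?_
  rw [ws_eigen_add, ws_eigen_mul]
  exact ws_key p

end Summit.HodgeConjecture.HodgeConjecture.Theorems.HeckePrymWeilLine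

end
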